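import Literature.NumberTheory.EllipticCurves.HeegnerPointsKolyvaginPrimaryEigenProofs
import Literature.NumberTheory.EllipticCurves.LocalPointsIntegersSubgroup
import HarnessLib

/-!
# The `±`-parts of `E(K_v)/p^k E(K_v)` at a place `v ∤ p`: `#(E(K_v)/p^k)^{φ = s} = p^k`
# (Jetchev 2008, §3.2 (2): `H¹_f(K_λ, E[p^m])^±` is free of rank one over `ℤ/p^m`)

Topic `NumberTheory/EllipticCurves`; namespace `Literature.NumberTheory.EllipticCurves`. THEOREMS ONLY:
no definition, no named fact, no `sorry` (D-0026).

## What

Jetchev, *Global divisibility of Heegner points and Tamagawa numbers*, Compos. Math. 144 (2008),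
§3.2 (2) (arXiv:math/0703431, p. 10): at a Kolyvagin prime `ℓ ∈ Λ¹_m`, `λ ∣ ℓ` the inert prime of the
imaginary quadratic field `K`, *"`H¹_ur(K_λ, E[p^m])^± ≅ E[p^m]^±` … The existence of the Weil pairing
implies that `E[p^m]` splits into two eigenspaces of complex conjugation each of which is free of rank
one over `ℤ/p^m` and thus `H¹_ur(K_λ, E[p^m])^±` and `H¹_tr(K_λ, E[p^m])^±` are all free of rank one
over `ℤ/p^m`"* — the local input of the proof of Lemma 5.2 (i) (p. 14: *"(i) follows from … the fact
that the `±`-parts `H¹_ur(K_λ,E[p^m])^±` … are free of rank one"*); with Prop. 4.2 (p. 9, *"Let `v` be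
a place of good reduction for `E`, `v ∤ p`. Then `H¹_ur(K_v, E[p^m]) = H¹_Kum(K_v, E[p^m])`"*) the
unramified condition is the image `E(K_λ)/p^m ↪ H¹(K_λ, E[p^m])` of the local Kummer map, and the
statement is: **the `s`-eigenspace (`s = ±1`) of the involution `τ_λ` on `E(K_λ)/p^m E(K_λ)` has
exactly `p^m` elements.** Gross, *Kolyvagin's work on modular elliptic curves* (1991), §4 (4.1)–(4.3)
is the case `m = 1`.

This file proves that count in the currency in which the tree's road-K kernel consumes it (the
`s`-eigen-kernel of the map induced by an endomorphism `φ` on `G ⧸ p^k G`, `G = E(K_v)` Mathlib's group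
of `K_v`-points), from three hypotheses on the `p`-power torsion of `E(K_v)` that hold at a Kolyvagin
prime (`Γ_{K_λ}` fixes `E[p^k]`, so `E(K_λ)[p^j] = E[p^j]` for `j ≤ k`, and the lift of complex
conjugation has both eigenvalues on `E[p]`): `#E(K_v)[p] ≤ p²`, `#E(K_v)[p^k] ≥ p^{2k}`, and `φ` is
not a scalar `±1` on `E(K_v)[p]`.

* §1 (pure algebra, `PrimaryQuotientEigen.*`). Let `G` be an abelian group with a finite-index subgroup
  `U` that is `p`-torsion-free and `p`-divisible (for `E(K_v)`, `v ∤ p`: Silverman VII.6.3), `p` odd,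
  `φ : G →+ G` an involution on the `p`-power torsion. Then every class of `G ⧸ p^k G` is the class of a
  `p`-power torsion element (`exists_torsion_sub_mem_range`: `G ⧸ p^k G ≅ G[p^∞] ⧸ p^k`), `[G : p^k G] =
  #G[p^k]`, and the Gross (5.1) `±`-bookkeeping of the tree (`KolyvaginEigenPow.*`: eigen-decomposition,
  `#S = #S⁺·#S⁻`, `#C[p] ≤ p ⇒ #C[p^j] ≤ p^j`) gives
  **`natCard_ker_map_sub_smul_eq`**: `#ker(φ̄ − s) = p^k` on `G ⧸ p^k G`.
* §2 (`E(K_v)`, `v ∤ p`). **`WeierstrassCurve.natCard_ker_map_sub_smul_quotient_adicCompletion_eq`**: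
  the same for `G = (W ⊗ K_v)(K_v)`, `W` an elliptic curve over a number field `K`, `v` a finite place
  with `p ∉ v` — the subgroup `U` is the tree's `WeierstrassCurve.exists_finiteIndex_torsionFree_adicCompletion`
  (AEC VII.6.3) with `[U : pU] = #(𝓞_v/p) = 1`.

What is NOT here (the consumer's side, `Summits/…/Theorems/Rank1ResidualJet*`): the identification of
the local Kummer condition with the image of `E(K_v)/p^k` and its `σ`-equivariance, and the discharge
of the three torsion hypotheses at a Kolyvagin prime from `Γ_{K_λ}` acting trivially on `E[p^k]`
(`absGaloisRestrict_smul_geomTorsion_eq_of_kolyvaginPrime_pow`).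

## References

* [Jetchev2008] D. Jetchev, *Global divisibility of Heegner points and Tamagawa numbers*, Compos.
  Math. 144 (2008) 811–826, §3.2 (2)–(3) (arXiv p. 10), Prop. 4.2 (arXiv p. 9), Lemma 5.2 (i) and its
  proof (arXiv p. 14; printed Lemma 3.4, p. 822).
* [GrossLMS1991] B. H. Gross, *Kolyvagin's work on modular elliptic curves*, LMS LNS 153 (1991), §4
  (4.1)–(4.3), §5 (5.1).
* [SilvermanAEC2009] J. H. Silverman, *The Arithmetic of Elliptic Curves*, 2nd ed., Prop. VII.6.3.
* [MilneADT2006] J. S. Milne, *Arithmetic Duality Theorems*, 2nd ed., I Lemma 3.3.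

Design: no definitions; §1 is `Type*`-polymorphic; §2 over `K : Type u`. Axioms: `propext`,
`Classical.choice`, `Quot.sound`.
-/

noncomputable section

open scoped Classical

universe u

namespace Literature.NumberTheory.EllipticCurves

namespace PrimaryQuotientEigen

variable {G : Type*} [AddCommGroup G] {p : ℕ}

/-! ## §1.1 Torsion-free and divisible subgroups: iterating -/

/-- A `p`-torsion-free subgroup is `p^j`-torsion-free. [folklore] -/
private theorem eq_zero_of_pow_nsmul_eq_zero (U : AddSubgroup G) (htf : ∀ u ∈ U, p • u = 0 → u = 0)
    (j : ℕ) {u : G} (hu : u ∈ U) (h : p ^ j • u = 0) : u = 0 := by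
  induction j generalizing u with
  | zero => simpa using h
  | succ j ih =>
    have h' : p ^ j • (p • u) = 0 := by rw [smul_smul, ← pow_succ, h]
    exact htf u hu (ih (U.nsmul_mem hu p) h')

/-- A `p`-divisible subgroup is `p^j`-divisible. [folklore] -/
private theorem exists_pow_nsmul_eq (U : AddSubgroup G) (hdiv : ∀ u ∈ U, ∃ u' ∈ U, p • u' = u)
    (j : ℕ) {u : G} (hu : u ∈ U) : ∃ u' ∈ U, p ^ j • u' = u := by
  induction j generalizing u with
  | zero => exact ⟨u, hu, by rw [pow_zero, one_smul]⟩
  | succ j ih =>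
    obtain ⟨u₁, hu₁, h₁⟩ := hdiv u hu
    obtain ⟨u₂, hu₂, h₂⟩ := ih hu₁
    exact ⟨u₂, hu₂, by rw [pow_succ', ← smul_smul, h₂, h₁]⟩

/-- A `p`-divisible subgroup lies in its image under multiplication by `p^j`:
`U ≤ p^j U`, i.e. `[U : p^j U ∩ U] = 1`. [folklore] -/
private theorem relIndex_map_nsmul_eq_one (U : AddSubgroup G)
    (hdiv : ∀ u ∈ U, ∃ u' ∈ U, p • u' = u) (j : ℕ) : (U.map (nsmulAddMonoidHom (p ^ j) : G →+ G)).relIndex U = 1 := by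
  rw [AddSubgroup.relIndex_eq_one]
  intro u hu
  obtain ⟨u', hu', h⟩ := exists_pow_nsmul_eq U hdiv j hu
  exact ⟨u', hu', h⟩

/-! ## §1.2 `G ⧸ p^k G ≅ G[p^∞] ⧸ p^k`: every class is the class of a torsion element -/

/-- **Every class of `G ⧸ p^k G` is represented by a `p`-power torsion element** when `G` has a
finite-index `p`-divisible subgroup `U`: if `[G : U] = p^a m'` with `p ∤ m'`, then for every `g` there
is `t` with `p^a t = 0` and `g − t ∈ p^k G`. (For `E(K_v)`, `v ∤ p`: `E(K_v)/p^k = E(K_v)[p^∞]/p^k`.)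
[folklore] -/
private theorem exists_torsion_sub_mem_range (hp : p.Prime) (U : AddSubgroup G)
    (hdiv : ∀ u ∈ U, ∃ u' ∈ U, p • u' = u) {a m' : ℕ} (hm : U.index = p ^ a * m') (hm' : ¬ p ∣ m')
    (k : ℕ) (g : G) :
    ∃ t : G, p ^ a • t = 0 ∧ g - t ∈ (nsmulAddMonoidHom (p ^ k) : G →+ G).range := by
  -- `p^a (m' g) ∈ U`, so `p^a (m' g) = p^a u` with `u ∈ U`
  have hgU : p ^ a • (m' • g) ∈ U := by
    rw [smul_smul, ← hm]
    exact U.nsmul_index_mem g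
  obtain ⟨u, hu, hu'⟩ := exists_pow_nsmul_eq U hdiv a hgU
  -- Bezout: `x m' + y p^k = 1`
  have hcop : Nat.Coprime m' (p ^ k) :=
    Nat.Coprime.pow_right k ((Nat.Prime.coprime_iff_not_dvd hp).mpr hm').symm
  obtain ⟨x, y, hxy⟩ : ∃ x y : ℤ, x * (m' : ℤ) + y * ((p ^ k : ℕ) : ℤ) = 1 :=
    Nat.isCoprime_iff_coprime.mpr hcop
  -- `x u ∈ U = p^k U`
  obtain ⟨u'', -, hu''⟩ := exists_pow_nsmul_eq U hdiv k (U.zsmul_mem hu x)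
  refine ⟨x • (m' • g - u), ?_, ⟨u'' + y • g, ?_⟩⟩
  · rw [smul_comm, smul_sub, hu', sub_self, smul_zero]
  · rw [nsmulAddMonoidHom_apply, smul_add, hu'', smul_sub, sub_sub_eq_add_sub, smul_comm,
      ← natCast_zsmul g (p ^ k), ← mul_smul, ← natCast_zsmul g m', ← mul_smul]
    -- goal: `x • u + (y * ↑(p^k)) • g = g + x • u - (x * ↑m') • g`
    have h1 : g = (x * (m' : ℤ)) • g + (y * ((p ^ k : ℕ) : ℤ)) • g := by
      rw [← add_smul, hxy, one_smul]
    nth_rewrite 2 [h1]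
    abel

/-- Every `p`-power torsion element is killed by `p^a`, `p^a` the `p`-part of `[G : U]`, when `U` is
`p`-torsion-free: `G[p^∞] = G[p^a]`. [folklore] -/
private theorem pow_nsmul_eq_zero_of_index (hp : p.Prime) (U : AddSubgroup G)
    (htf : ∀ u ∈ U, p • u = 0 → u = 0) {a m' : ℕ} (hm : U.index = p ^ a * m') (hm' : ¬ p ∣ m')
    {t : G} {j : ℕ} (ht : p ^ j • t = 0) : p ^ a • t = 0 := by
  -- `[G:U] t ∈ U` is torsion, hence `0`: `p^a (m' t) = 0`
  have h0 : p ^ a • (m' • t) = 0 := by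
    rw [smul_smul, ← hm]
    refine eq_zero_of_pow_nsmul_eq_zero U htf j (U.nsmul_index_mem t) ?_
    rw [smul_comm, ht, smul_zero]
  -- Bezout `x m' + y p^j = 1`
  have hcop : Nat.Coprime m' (p ^ j) :=
    Nat.Coprime.pow_right j ((Nat.Prime.coprime_iff_not_dvd hp).mpr hm').symm
  obtain ⟨x, y, hxy⟩ : ∃ x y : ℤ, x * (m' : ℤ) + y * ((p ^ j : ℕ) : ℤ) = 1 :=
    Nat.isCoprime_iff_coprime.mpr hcop
  calc p ^ a • t = p ^ a • ((x * (m' : ℤ) + y * ((p ^ j : ℕ) : ℤ)) • t) := by rw [hxy, one_smul]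
    _ = x • (p ^ a • (m' • t)) + y • (p ^ a • (p ^ j • t)) := by
      rw [add_smul, smul_add, mul_smul, mul_smul, natCast_zsmul, natCast_zsmul, smul_comm (p ^ a) x,
        smul_comm (p ^ a) y]
    _ = 0 := by rw [h0, ht, smul_zero, smul_zero, smul_zero, add_zero]


/-! ## §1.3 Counting helpers -/

/-- For an endomorphism `f` of a finite abelian group, `[S : f(S)] = #ker f`. [folklore] -/
private theorem index_range_eq_natCard_ker {S : Type*} [AddCommGroup S] [Finite S] (f : S →+ S) :
    f.range.index = Nat.card f.ker := by
  have h1 : Nat.card S = f.range.index * Nat.card f.range :=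
    AddSubgroup.card_eq_card_quotient_mul_card_addSubgroup f.range
  have h2 : Nat.card S = Nat.card f.ker * Nat.card f.range := by
    rw [AddSubgroup.card_eq_card_quotient_mul_card_addSubgroup f.ker,
      Nat.card_congr (QuotientAddGroup.quotientKerEquivRange f).toEquiv, mul_comm]
  have hr : Nat.card f.range ≠ 0 := Nat.card_pos.ne'
  exact Nat.eq_of_mul_eq_mul_right (Nat.pos_of_ne_zero hr) (h1.symm.trans h2)

/-- If `π` kills `n S`, then `#π(S) ≤ #S[n]` (`π(S) ≅ S/(S ∩ ker π)` and `n S ≤ ker π`). [folklore] -/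
private theorem natCard_map_le_natCard_ker_nsmul {T : Type*} [AddCommGroup T] (π : G →+ T)
    (S : AddSubgroup G) [Finite S] (n : ℕ) (hπ : ∀ t ∈ S, π (n • t) = 0) :
    Nat.card (S.map π) ≤ Nat.card (nsmulAddMonoidHom n : S →+ S).ker := by
  set ψ : S →+ T := π.comp S.subtype with hψ
  have hmap : S.map π = ψ.range := by
    rw [hψ, AddMonoidHom.range_comp, AddSubgroup.range_subtype]
  have hle : (nsmulAddMonoidHom n : S →+ S).range ≤ ψ.ker := by
    rintro _ ⟨t, rfl⟩
    rw [AddMonoidHom.mem_ker, nsmulAddMonoidHom_apply, hψ, AddMonoidHom.comp_apply,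
      AddSubgroup.subtype_apply, AddSubgroup.coe_nsmul]
    exact hπ t t.2
  rw [hmap, ← AddSubgroup.index_ker, ← index_range_eq_natCard_ker]
  haveI : Finite (S ⧸ (nsmulAddMonoidHom n : S →+ S).range) := inferInstance
  exact Nat.le_of_dvd (Nat.pos_of_ne_zero AddSubgroup.index_ne_zero_of_finite)
    (AddSubgroup.index_dvd_of_le hle)

/-- `#S[n]` as a `Finset` count. [folklore] -/
private theorem natCard_ker_nsmul_eq_card_filter {S : Type*} [AddCommGroup S] [Fintype S] [DecidableEq S]
    (n : ℕ) : Nat.card (nsmulAddMonoidHom n : S →+ S).ker =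
      (Finset.univ.filter fun g : S => n • g = 0).card := by
  rw [Nat.card_congr (Equiv.subtypeEquivRight (fun x => by
      rw [AddMonoidHom.mem_ker, nsmulAddMonoidHom_apply]) :
      (nsmulAddMonoidHom n : S →+ S).ker ≃ {g : S // n • g = 0}),
    Nat.card_eq_fintype_card, Fintype.card_subtype]

/-- An element of prime order `p` with a property stable under multiples gives `p` elements with that
property. [folklore] -/
private theorem le_natCard_subtype_of_nsmul (hp : p.Prime) {P : G → Prop} {x : G} (hx : p • x = 0)
    (hx0 : x ≠ 0)
    (hP : ∀ i : ℕ, P (i • x)) (hfin : Finite {y : G // P y}) : p ≤ Nat.card {y : G // P y} := by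
  haveI : Fact p.Prime := ⟨hp⟩
  have hord : addOrderOf x = p := addOrderOf_eq_prime hx hx0
  have hinj : Function.Injective fun i : Fin p => (⟨(i : ℕ) • x, hP i⟩ : {y : G // P y}) := by
    intro i j hij
    have h := congrArg Subtype.val hij
    simp only at h
    rw [nsmul_inj_mod, hord, Nat.mod_eq_of_lt i.2, Nat.mod_eq_of_lt j.2] at h
    exact Fin.ext h
  simpa using Nat.card_le_card_of_injective _ hinj

/-! ## §1.4 The count `#(G ⧸ p^k G)^{φ = s} = p^k` -/

/-- **`#(G ⧸ p^k G)^{φ̄ = s} = p^k`** (Jetchev 2008 §3.2 (2) / Lemma 5.2 (i), local input, in quotient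
currency). Let `p` be an odd prime, `G` an abelian group with a finite-index subgroup `U` that is
`p`-torsion-free and `p`-divisible, `φ` an endomorphism of `G` that is an involution on the `p`-power
torsion, with `#G[p] ≤ p²`, `#G[p^k] ≥ p^{2k}`, and `φ` not a scalar `±1` on `G[p]`. Then for
`R = p^k G` and `s = ±1` the kernel of `φ̄ − s` on `G ⧸ R` has exactly `p^k` elements. Proof: `G ⧸ R`
is killed by `p^k` and every class is represented by a torsion element (`exists_torsion_sub_mem_range`),
so `φ̄` is an involution and `#(G ⧸ R) = #(G⧸R)⁺ · #(G⧸R)⁻` (Gross (5.1), tree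
`KolyvaginEigenPow.card_eq_card_mul_card`) `= [G : R] = #G[p^k] ≥ p^{2k}`; and `(G⧸R)^{±}` is the
image of the `±`-part `S_±` of the torsion, of order `≤ [S_± : p^k S_±] = #S_±[p^k] ≤ p^k` because
`#S_±[p] ≤ p` (`#G[p] = #G[p]⁺ #G[p]⁻ ≤ p²` with both factors `≥ p`).
[cite: Jetchev2008, §3.2 (2) (arXiv p. 10) and Lemma 5.2 (i) proof (arXiv p. 14)]
[cite: GrossLMS1991, §4 (4.1)–(4.3), §5 (5.1)] -/
theorem natCard_ker_map_sub_smul_eq (hp : p.Prime) (hp2 : p ≠ 2) (U : AddSubgroup G) [U.FiniteIndex]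
    (htf : ∀ u ∈ U, p • u = 0 → u = 0) (hdiv : ∀ u ∈ U, ∃ u' ∈ U, p • u' = u)
    (φ : G →+ G) (hφ : ∀ x : G, (∃ j : ℕ, p ^ j • x = 0) → φ (φ x) = x)
    (h1 : Nat.card (nsmulAddMonoidHom p : G →+ G).ker ≤ p ^ 2) (k : ℕ)
    (h2 : p ^ (2 * k) ≤ Nat.card (nsmulAddMonoidHom (p ^ k) : G →+ G).ker)
    (hns : ∀ s : ℤ, s = 1 ∨ s = -1 → ∃ x : G, p • x = 0 ∧ φ x ≠ s • x)
    (R : AddSubgroup G) (hR : R = (nsmulAddMonoidHom (p ^ k) : G →+ G).range) (hφR : R ≤ R.comap φ)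
    {s : ℤ} (hs : s = 1 ∨ s = -1) :
    Nat.card (QuotientAddGroup.map R R φ hφR - s • AddMonoidHom.id (G ⧸ R)).ker = p ^ k := by
  haveI : Fact p.Prime := ⟨hp⟩
  have hp0 : 0 < p := hp.pos
  -- the `p`-part `p^a` of `[G : U]`; all `p`-power torsion is `p^a`-torsion
  obtain ⟨a, m', hm', hm⟩ := Nat.exists_eq_pow_mul_and_not_dvd
    (AddSubgroup.FiniteIndex.index_ne_zero (H := U)) p hp.one_lt.ne'
  have htfj : ∀ (j : ℕ), ∀ u ∈ U, p ^ j • u = 0 → u = 0 := fun j u hu h =>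
    eq_zero_of_pow_nsmul_eq_zero U htf j hu h
  set A : AddSubgroup G := (nsmulAddMonoidHom (p ^ a) : G →+ G).ker with hA
  have hmemA : ∀ {t : G}, t ∈ A ↔ p ^ a • t = 0 := fun {t} => by
    rw [hA, AddMonoidHom.mem_ker, nsmulAddMonoidHom_apply]
  have hAof : ∀ {t : G} {j : ℕ}, p ^ j • t = 0 → t ∈ A := fun ht =>
    hmemA.mpr (pow_nsmul_eq_zero_of_index hp U htf hm hm' ht)
  haveI hAfin : Finite A := LocalPoints.finite_ker_nsmul U (p ^ a) (htfj a)
  have hφA : ∀ t ∈ A, φ t ∈ A := fun t ht =>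
    hmemA.mpr (by rw [← map_nsmul, hmemA.mp ht, map_zero])
  have hφφ : ∀ t ∈ A, φ (φ t) = t := fun t ht => hφ t ⟨a, hmemA.mp ht⟩
  -- `T = G ⧸ R`, `π`, `φ̄`
  set π : G →+ G ⧸ R := QuotientAddGroup.mk' R with hπ
  set φb : G ⧸ R →+ G ⧸ R := QuotientAddGroup.map R R φ hφR with hφb
  have hφb_mk : ∀ g : G, φb (g : G ⧸ R) = ((φ g : G) : G ⧸ R) := fun g => QuotientAddGroup.map_mk R R φ hφR g
  have hmemR : ∀ {g : G}, g ∈ R ↔ ∃ y : G, p ^ k • y = g := fun {g} => by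
    rw [hR, AddMonoidHom.mem_range]; simp only [nsmulAddMonoidHom_apply]
  have hTkill : ∀ z : G ⧸ R, p ^ k • z = 0 := by
    intro z
    obtain ⟨g, rfl⟩ := QuotientAddGroup.mk_surjective z
    rw [← QuotientAddGroup.mk_nsmul, QuotientAddGroup.eq_zero_iff]
    exact hmemR.mpr ⟨g, rfl⟩
  -- every class is the class of an element of `A`
  have hrep : ∀ z : G ⧸ R, ∃ t ∈ A, (t : G ⧸ R) = z := by
    intro z
    obtain ⟨g, rfl⟩ := QuotientAddGroup.mk_surjective z
    obtain ⟨t, ht, hgt⟩ := exists_torsion_sub_mem_range hp U hdiv hm hm' k g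
    refine ⟨t, hmemA.mpr ht, ?_⟩
    rw [eq_comm, QuotientAddGroup.eq_iff_sub_mem]
    rwa [hR]
  have hφbinv : ∀ z : G ⧸ R, φb (φb z) = z := by
    intro z
    obtain ⟨t, ht, rfl⟩ := hrep z
    rw [hφb_mk, hφb_mk, hφφ t ht]
  -- finiteness of `G[p^j]` and of `G ⧸ R`
  haveI hPfin : ∀ j : ℕ, Finite (nsmulAddMonoidHom (p ^ j) : G →+ G).ker := fun j =>
    LocalPoints.finite_ker_nsmul U (p ^ j) (htfj j)
  have hidx : R.index = Nat.card (nsmulAddMonoidHom (p ^ k) : G →+ G).ker := by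
    rw [hR, LocalPoints.index_range_nsmul_eq U (p ^ k) (htfj k), relIndex_map_nsmul_eq_one U hdiv k,
      one_mul]
  haveI hTfin : Finite (G ⧸ R) := by
    refine Nat.finite_of_card_ne_zero ?_
    rw [← AddSubgroup.index, hidx]
    exact Nat.card_pos.ne'
  -- (F1)+(F2): `#T⁺ · #T⁻ = #T = #G[p^k] ≥ p^{2k}`
  have hprod : p ^ (2 * k) ≤ Nat.card {z : G ⧸ R // φb z = (1 : ℤ) • z} *
      Nat.card {z : G ⧸ R // φb z = (-1 : ℤ) • z} := by
    have h := KolyvaginEigenPow.card_eq_card_mul_card (M := k) hp hp2 hTkill φb hφbinv ⊤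
      (fun _ _ => AddSubgroup.mem_top _)
    rw [AddSubgroup.card_top] at h
    have e1 : {x : G ⧸ R // x ∈ (⊤ : AddSubgroup (G ⧸ R)) ∧ φb x = x} ≃
        {z : G ⧸ R // φb z = (1 : ℤ) • z} :=
      Equiv.subtypeEquivRight fun x => by simp
    have e2 : {x : G ⧸ R // x ∈ (⊤ : AddSubgroup (G ⧸ R)) ∧ φb x = -x} ≃
        {z : G ⧸ R // φb z = (-1 : ℤ) • z} :=
      Equiv.subtypeEquivRight fun x => by simp
    rw [Nat.card_congr e1, Nat.card_congr e2] at h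
    rw [← h]
    calc p ^ (2 * k) ≤ Nat.card (nsmulAddMonoidHom (p ^ k) : G →+ G).ker := h2
      _ = Nat.card (G ⧸ R) := by rw [← hidx]; rfl
  -- (F3): `#T^{s'} ≤ p^k` for `s' = ±1`
  have hle : ∀ s' : ℤ, s' = 1 ∨ s' = -1 → Nat.card {z : G ⧸ R // φb z = s' • z} ≤ p ^ k := by
    intro s' hs'
    -- the `s'`-part of the torsion
    set S : AddSubgroup G := A ⊓ (φ - s' • AddMonoidHom.id G).ker with hSdef
    have hmemS : ∀ {t : G}, t ∈ S ↔ t ∈ A ∧ φ t = s' • t := fun {t} => by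
      rw [hSdef, AddSubgroup.mem_inf]
      refine and_congr Iff.rfl ?_
      rw [AddMonoidHom.mem_ker, AddMonoidHom.sub_apply, AddMonoidHom.smul_apply,
        AddMonoidHom.id_apply, sub_eq_zero]
    haveI hSfin : Finite S := Finite.of_injective (AddSubgroup.inclusion (inf_le_left : S ≤ A))
      (AddSubgroup.inclusion_injective _)
    -- (i) every `s'`-eigenclass is the class of an element of `S`
    have hsurj : ∀ z : G ⧸ R, φb z = s' • z → ∃ t ∈ S, (t : G ⧸ R) = z := by
      intro z hz
      obtain ⟨t, ht, rfl⟩ := hrep z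
      -- decompose `t = t₊ + t₋` inside `A` (killed by `p^a`)
      have hAkill : ∀ x : A, p ^ a • x = 0 := fun x => Subtype.ext (hmemA.mp x.2)
      set φA : A →+ A := (φ.comp A.subtype).codRestrict A (fun x => hφA x x.2) with hφAdef
      have hφA_coe : ∀ x : A, ((φA x : A) : G) = φ (x : G) := fun x => rfl
      have hφAinv : ∀ x : A, φA (φA x) = x := fun x => Subtype.ext (hφφ x x.2)
      obtain ⟨u, w, hu, hw, huw⟩ :=
        KolyvaginEigenPow.exists_eigen_add_eigen (M := a) hp hp2 hAkill φA hφAinv ⟨t, ht⟩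
      have hu' : φ (u : G) = u := by rw [← hφA_coe, hu]
      have hw' : φ (w : G) = -(w : G) := by rw [← hφA_coe, hw]; rfl
      have htuw : t = (u : G) + w := congrArg Subtype.val huw
      -- `φ̄ [t] = s' [t]` forces the other component to vanish in `G ⧸ R`
      rw [hφb_mk, htuw, map_add, hu', hw'] at hz
      rcases hs' with rfl | rfl
      · refine ⟨u, hmemS.mpr ⟨u.2, by rw [hu', one_smul]⟩, ?_⟩
        -- `[u] + [-w] = [u] + [w]` ⇒ `2 [w] = 0` ⇒ `[w] = 0`
        have h2w : (2 : ℕ) • ((w : G) : G ⧸ R) = 0 := by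
          rw [one_smul, QuotientAddGroup.mk_add, QuotientAddGroup.mk_add, QuotientAddGroup.mk_neg,
            add_right_inj, neg_eq_iff_add_eq_zero, ← two_nsmul] at hz
          exact hz
        have hw0 : ((w : G) : G ⧸ R) = 0 :=
          KolyvaginEigenPow.eq_zero_of_two_nsmul_eq_zero (M := k) hp hp2 hTkill h2w
        rw [htuw, QuotientAddGroup.mk_add, hw0, add_zero]
      · refine ⟨w, hmemS.mpr ⟨w.2, by rw [hw', neg_one_smul]⟩, ?_⟩
        have h2u : (2 : ℕ) • ((u : G) : G ⧸ R) = 0 := by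
          rw [neg_one_smul, QuotientAddGroup.mk_add, QuotientAddGroup.mk_add, QuotientAddGroup.mk_neg,
            neg_add, add_left_inj, eq_neg_iff_add_eq_zero, ← two_nsmul] at hz
          exact hz
        have hu0 : ((u : G) : G ⧸ R) = 0 :=
          KolyvaginEigenPow.eq_zero_of_two_nsmul_eq_zero (M := k) hp hp2 hTkill h2u
        rw [htuw, QuotientAddGroup.mk_add, hu0, zero_add]
    -- (ii) so `#T^{s'} ≤ #π(S)`
    have hii : Nat.card {z : G ⧸ R // φb z = s' • z} ≤ Nat.card (S.map π) := by
      refine Nat.card_le_card_of_injective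
        (fun z => (⟨z.1, ?_⟩ : S.map π))
        (fun z₁ z₂ h => Subtype.ext (by simpa using congrArg Subtype.val h))
      obtain ⟨t, ht, htz⟩ := hsurj z.1 z.2
      exact AddSubgroup.mem_map.mpr ⟨t, ht, htz⟩
    -- (iii) `#π(S) ≤ #S[p^k]`
    have hiii : Nat.card (S.map π) ≤ Nat.card (nsmulAddMonoidHom (p ^ k) : S →+ S).ker :=
      natCard_map_le_natCard_ker_nsmul π S (p ^ k) fun t _ => by
        rw [hπ, QuotientAddGroup.mk'_apply, QuotientAddGroup.eq_zero_iff]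
        exact hmemR.mpr ⟨t, rfl⟩
    -- (v) `#S[p] ≤ p`: `#G[p] = #G[p]⁺ · #G[p]⁻ ≤ p²` with `#G[p]^{−s'} ≥ p`
    have hv : Nat.card {g : S // p • g = 0} ≤ p := by
      set P1 : AddSubgroup G := (nsmulAddMonoidHom p : G →+ G).ker with hP1
      have hmemP1 : ∀ {t : G}, t ∈ P1 ↔ p • t = 0 := fun {t} => by
        rw [hP1, AddMonoidHom.mem_ker, nsmulAddMonoidHom_apply]
      haveI : Finite P1 := by
        have h := hPfin 1
        rwa [pow_one] at h
      have hP1A : ∀ {t : G}, t ∈ P1 → t ∈ A := fun ht =>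
        hAof (j := 1) (by rw [pow_one]; exact hmemP1.mp ht)
      have hP1kill : ∀ x : P1, p ^ 1 • x = 0 := fun x => Subtype.ext (by
        rw [pow_one]; exact hmemP1.mp x.2)
      have hφP1 : ∀ t ∈ P1, φ t ∈ P1 := fun t ht =>
        hmemP1.mpr (by rw [← map_nsmul, hmemP1.mp ht, map_zero])
      set φ1 : P1 →+ P1 := (φ.comp P1.subtype).codRestrict P1 (fun x => hφP1 x x.2) with hφ1def
      have hφ1_coe : ∀ x : P1, ((φ1 x : P1) : G) = φ (x : G) := fun x => rfl
      have hφ1inv : ∀ x : P1, φ1 (φ1 x) = x := fun x => Subtype.ext (hφφ x (hP1A x.2))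
      have hdec := KolyvaginEigenPow.card_eq_card_mul_card (M := 1) hp hp2 hP1kill φ1 hφ1inv ⊤
        (fun _ _ => AddSubgroup.mem_top _)
      rw [AddSubgroup.card_top] at hdec
      -- the eigen-parts of `G[p]` as subtypes of `G`
      have ecard : ∀ s₁ : ℤ, Nat.card {x : P1 // x ∈ (⊤ : AddSubgroup P1) ∧ φ1 x = s₁ • x} =
          Nat.card {x : G // p • x = 0 ∧ φ x = s₁ • x} := fun s₁ =>
        Nat.card_congr
          { toFun := fun x => ⟨x.1.1, hmemP1.mp x.1.2, by
              have h := congrArg Subtype.val x.2.2; rwa [hφ1_coe, AddSubgroup.coe_zsmul] at h⟩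
            invFun := fun x => ⟨⟨x.1, hmemP1.mpr x.2.1⟩, AddSubgroup.mem_top _, Subtype.ext (by
              rw [hφ1_coe, AddSubgroup.coe_zsmul]; exact x.2.2)⟩
            left_inv := fun x => by ext; rfl
            right_inv := fun x => by ext; rfl }
      have e1 : Nat.card {x : P1 // x ∈ (⊤ : AddSubgroup P1) ∧ φ1 x = x} =
          Nat.card {x : G // p • x = 0 ∧ φ x = (1 : ℤ) • x} := by
        rw [← ecard 1]; exact Nat.card_congr (Equiv.subtypeEquivRight fun x => by simp)
      have e2 : Nat.card {x : P1 // x ∈ (⊤ : AddSubgroup P1) ∧ φ1 x = -x} =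
          Nat.card {x : G // p • x = 0 ∧ φ x = (-1 : ℤ) • x} := by
        rw [← ecard (-1)]; exact Nat.card_congr (Equiv.subtypeEquivRight fun x => by simp)
      rw [e1, e2] at hdec
      -- `#S[p]` is the `s'`-part of `G[p]`
      have eS : Nat.card {g : S // p • g = 0} = Nat.card {x : G // p • x = 0 ∧ φ x = s' • x} :=
        Nat.card_congr
          { toFun := fun g => ⟨g.1.1, by
                have h := congrArg Subtype.val g.2; rwa [AddSubgroup.coe_nsmul] at h,
              (hmemS.mp g.1.2).2⟩
            invFun := fun x => ⟨⟨x.1, hmemS.mpr ⟨hP1A (hmemP1.mpr x.2.1), x.2.2⟩⟩, Subtype.ext (by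
              rw [AddSubgroup.coe_nsmul]; exact x.2.1)⟩
            left_inv := fun g => by ext; rfl
            right_inv := fun x => by ext; rfl }
      rw [eS]
      -- finiteness of the eigen-subtypes of `G[p]`
      have hfinP : ∀ s₁ : ℤ, Finite {x : G // p • x = 0 ∧ φ x = s₁ • x} := fun s₁ =>
        Finite.of_injective (fun x => (⟨x.1, hmemP1.mpr x.2.1⟩ : P1))
          (fun x y h => Subtype.ext (by simpa using congrArg Subtype.val h))
      -- the `−s'`-part has at least `p` elements
      obtain ⟨x, hxp, hxs⟩ := hns s' hs'
      obtain ⟨u, w, hu, hw, huw⟩ :=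
        KolyvaginEigenPow.exists_eigen_add_eigen (M := 1) hp hp2 hP1kill φ1 hφ1inv ⟨x, hmemP1.mpr hxp⟩
      have hu' : φ (u : G) = u := by rw [← hφ1_coe, hu]
      have hw' : φ (w : G) = -(w : G) := by rw [← hφ1_coe, hw]; rfl
      have hxuw : x = (u : G) + w := congrArg Subtype.val huw
      have hcardP1 : Nat.card P1 ≤ p ^ 2 := h1
      rcases hs' with rfl | rfl
      · -- `w ≠ 0` (else `φ x = x`), so `#G[p]⁻ ≥ p`
        have hw0 : (w : G) ≠ 0 := by
          intro h0
          apply hxs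
          rw [hxuw, h0, add_zero, hu', one_smul]
        have hge : p ≤ Nat.card {x : G // p • x = 0 ∧ φ x = (-1 : ℤ) • x} :=
          le_natCard_subtype_of_nsmul hp (hmemP1.mp w.2) hw0 (fun i =>
            ⟨by rw [smul_comm, hmemP1.mp w.2, smul_zero], by
              rw [map_nsmul, hw', neg_one_smul, smul_neg]⟩) (hfinP (-1))
        have h := hcardP1
        rw [hdec, pow_two] at h
        exact Nat.le_of_mul_le_mul_right (le_trans (Nat.mul_le_mul_left _ hge) h) hp0
      · have hu0 : (u : G) ≠ 0 := by
          intro h0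
          apply hxs
          rw [hxuw, h0, zero_add, hw', neg_one_smul]
        have hge : p ≤ Nat.card {x : G // p • x = 0 ∧ φ x = (1 : ℤ) • x} :=
          le_natCard_subtype_of_nsmul hp (hmemP1.mp u.2) hu0 (fun i =>
            ⟨by rw [smul_comm, hmemP1.mp u.2, smul_zero], by rw [map_nsmul, hu', one_smul]⟩)
            (hfinP 1)
        have h := hcardP1
        rw [hdec, pow_two] at h
        exact Nat.le_of_mul_le_mul_left (le_trans (Nat.mul_le_mul_right _ hge) h) hp0
    -- (iv) `#S[p^k] ≤ p^k`
    have hiv : Nat.card (nsmulAddMonoidHom (p ^ k) : S →+ S).ker ≤ p ^ k := by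
      letI : Fintype S := Fintype.ofFinite S
      rw [natCard_ker_nsmul_eq_card_filter]
      refine KolyvaginEigenPow.card_filter_pow_nsmul_le ?_ k
      rw [← Fintype.card_subtype, ← Nat.card_eq_fintype_card]
      exact hv
    exact hii.trans (hiii.trans hiv)
  -- (F4): conclude
  have hle1 := hle 1 (Or.inl rfl)
  have hle2 := hle (-1) (Or.inr rfl)
  have heq : ∀ s' : ℤ, s' = 1 ∨ s' = -1 → Nat.card {z : G ⧸ R // φb z = s' • z} = p ^ k := by
    intro s' hs'
    have hpk : 0 < p ^ k := pow_pos hp0 k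
    rcases hs' with rfl | rfl
    · refine le_antisymm hle1 (not_lt.mp fun hlt => ?_)
      have : Nat.card {z : G ⧸ R // φb z = (1 : ℤ) • z} *
          Nat.card {z : G ⧸ R // φb z = (-1 : ℤ) • z} < p ^ k * p ^ k :=
        Nat.mul_lt_mul_of_lt_of_le hlt hle2 hpk
      rw [← pow_add, ← two_mul] at this
      exact absurd hprod (not_le.mpr this)
    · refine le_antisymm hle2 (not_lt.mp fun hlt => ?_)
      have : Nat.card {z : G ⧸ R // φb z = (1 : ℤ) • z} *
          Nat.card {z : G ⧸ R // φb z = (-1 : ℤ) • z} < p ^ k * p ^ k :=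
        Nat.mul_lt_mul_of_le_of_lt hle1 hlt hpk
      rw [← pow_add, ← two_mul] at this
      exact absurd hprod (not_le.mpr this)
  rw [← heq s hs]
  exact Nat.card_congr (Equiv.subtypeEquivRight fun z => by
    rw [AddMonoidHom.mem_ker, AddMonoidHom.sub_apply, AddMonoidHom.smul_apply, AddMonoidHom.id_apply,
      sub_eq_zero])

end PrimaryQuotientEigen

/-! ## §2 `E(K_v)` at a finite place `v ∤ p` -/

open NumberField IsDedekindDomain

variable {K : Type u} [Field K] [NumberField K]

/-- **`#(E(K_v)/p^k E(K_v))^{φ̄ = s} = p^k` at a finite place `v ∤ p`** (Jetchev 2008, §3.2 (2):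
*"`H¹_ur(K_λ, E[p^m])^±` … free of rank one over `ℤ/p^m`"*, with Prop. 4.2 `H¹_ur = H¹_Kum` = the
image of `E(K_λ)/p^m`; Gross 1991 §4 (4.1)–(4.3) for `m = 1`). Let `W` be an elliptic curve over a
number field `K`, `v` a finite place with `p ∉ v` (`p` an odd prime), `E(K_v)` Mathlib's group of
`K_v`-points of `W ⊗ K_v` (`K_v = v.adicCompletion K`), `φ` an endomorphism of `E(K_v)` that is an
involution on its `p`-power torsion (e.g. the action of an involution of `K_v`), and suppose
`#E(K_v)[p] ≤ p²`, `#E(K_v)[p^k] ≥ p^{2k}` and `φ` is not a scalar `±1` on `E(K_v)[p]` (at a Kolyvagin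
prime: `E(K_λ)[p^j] = E[p^j]` for `j ≤ k` and complex conjugation has both eigenvalues on `E[p]`). Then
for `R = p^k E(K_v)` and `s = ±1`, the kernel of `φ̄ − s` on `E(K_v) ⧸ R` has exactly `p^k` elements.
The finite-index, torsion-free, `p`-divisible subgroup is Silverman VII.6.3 (tree
`WeierstrassCurve.exists_finiteIndex_torsionFree_adicCompletion`, `[U : pU] = #(𝓞_v / p) = 1`).
Deliberate dot-notation extension of Mathlib's `WeierstrassCurve` namespace.
[cite: Jetchev2008, §3.2 (2) (arXiv p. 10), Prop. 4.2 (arXiv p. 9), Lemma 5.2 (i) proof (arXiv p. 14)]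
[cite: GrossLMS1991, §4 (4.1)–(4.3)] [cite: SilvermanAEC2009, Prop. VII.6.3] -/
theorem _root_.WeierstrassCurve.natCard_ker_map_sub_smul_quotient_adicCompletion_eq
    (W : WeierstrassCurve K) [W.IsElliptic] (v : HeightOneSpectrum (𝓞 K)) {p : ℕ} (hp : p.Prime)
    (hp2 : p ≠ 2) (hv : (p : 𝓞 K) ∉ v.asIdeal)
    (φ : (W.baseChange (v.adicCompletion K)).toAffine.Point →+
      (W.baseChange (v.adicCompletion K)).toAffine.Point)
    (hφ : ∀ P : (W.baseChange (v.adicCompletion K)).toAffine.Point,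
      (∃ j : ℕ, p ^ j • P = 0) → φ (φ P) = P)
    (h1 : Nat.card (nsmulAddMonoidHom p :
      (W.baseChange (v.adicCompletion K)).toAffine.Point →+ _).ker ≤ p ^ 2)
    (k : ℕ) (h2 : p ^ (2 * k) ≤ Nat.card (nsmulAddMonoidHom (p ^ k) :
      (W.baseChange (v.adicCompletion K)).toAffine.Point →+ _).ker)
    (hns : ∀ s : ℤ, s = 1 ∨ s = -1 → ∃ P : (W.baseChange (v.adicCompletion K)).toAffine.Point,
      p • P = 0 ∧ φ P ≠ s • P)
    (R : AddSubgroup (W.baseChange (v.adicCompletion K)).toAffine.Point)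
    (hR : R = (nsmulAddMonoidHom (p ^ k) :
      (W.baseChange (v.adicCompletion K)).toAffine.Point →+ _).range)
    (hφR : R ≤ R.comap φ) {s : ℤ} (hs : s = 1 ∨ s = -1) :
    Nat.card (QuotientAddGroup.map R R φ hφR - s • AddMonoidHom.id _).ker = p ^ k := by
  obtain ⟨U, hU, htf, hidx⟩ := W.exists_finiteIndex_torsionFree_adicCompletion v
  haveI := hU
  -- `[U : pU] = #(𝓞_v / p) = 1`: `p` is a `v`-adic unit
  have hone : Nat.card (v.adicCompletionIntegers K ⧸
      Ideal.span {(p : v.adicCompletionIntegers K)}) = 1 := by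
    have hu : IsUnit (p : v.adicCompletionIntegers K) := by
      rw [LocalPoints.isUnit_iff_valuation_eq_one]
      have h := LocalPoints.valuation_natCast_eq_one v hv
      convert h using 2
      simp
    haveI : Subsingleton (v.adicCompletionIntegers K ⧸
        Ideal.span {(p : v.adicCompletionIntegers K)}) :=
      Ideal.Quotient.subsingleton_iff.mpr (Ideal.span_singleton_eq_top.mpr hu)
    exact Nat.card_of_subsingleton 0
  have hdiv : ∀ u ∈ U, ∃ u' ∈ U, p • u' = u := by
    have h := hidx p hp.ne_zero
    rw [hone, AddSubgroup.relIndex_eq_one] at h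
    intro u hu
    obtain ⟨u', hu', h'⟩ := h hu
    exact ⟨u', hu', h'⟩
  exact PrimaryQuotientEigen.natCard_ker_map_sub_smul_eq hp hp2 U (htf p hp.ne_zero) hdiv φ hφ h1 k
    h2 hns R hR hφR hs

end Literature.NumberTheory.EllipticCurves

end
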